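import Summits.Ventures.HSemireg.ObstructionLocusKodaira
import Summits.Ventures.HSemireg.ObstructionLocusCompanions

/-!
# Venture HSemireg — (S5) OBSTRUCTION LOCUS away from secant type, V: the ONE necessary criterion «(NC): a `G`-semiregular
# object follows every `G`-invariant pp direction» and its follow-sets (reducible point · Jacobian), by DIMENSION COUNT

HONEST FRAMING.  Part of the Lean side of the computation cell `pub-hsemireg` (track «S4-PUSH» (ii), seat s4-prove-2):
G2-DEFORM-SANITY §C.2(d) / STRUCTURE §2 (S-B) «ONE necessary criterion, three follow-sets (coordinate arrangements: trivial
only; curve-bound: g ≤ 3; ppav-natural: Fol = T𝒜ₙ by construction)» as a dimension-count theorem over an arbitrary field,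
with the two geometric inputs as NAMED hypothesis shapes: **(H-NC′)** «`G`-semiregular ⟹ the follow-set contains every
`G`-invariant pp direction» (Buchweitz–Flenner `σ∘ob = ±⌟ch` + `ch ∈ ℚ[b]`, as (H-NC) of file I) and, per anchor, the
IDENTIFICATION of the follow-set (`Fol(W) ∩ Sym =` the diagonal at the reducible point — a kernel THEOREM of file II given
(H-arr); `Fol(W_d) = T𝓜_g` at a Jacobian — Lombardi–Tirabassi arXiv:1410.7986 Cor. 1.5, dictionary only, entering as the
bound `dim Fol ≤ 3g − 3`).  Nothing here constructs a variety or an obstruction class; nothing here says that HC / HC_CM /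
HC_AV holds; no Literature fact is declared or used.

* `AnchoredObject.not_semiregular_of_finrank_lt` — (NC) by count: `dim (Fol ∩ A^G) < dim A^G ⟹` NOT `G`-semiregular.
* `not_semiregular_reducible_of_count` — reducible point, COUNT route (G2-REDUCIBLE-POINT §3: «second, count-free proof»
  is file I's G2-ARR; this is the count proof): with `A^G =` all pp directions (`dim = n + C(n,2)`, `finrank_PPData`) and
  `Fol ∩ Sym =` the kernel of the Kodaira map on pp coordinates (`dim = n`, `finrank_ker_kodairaMap_pp`), `C(n,2) > 0` for
  `n ≥ 3` kills semiregularity.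
* `not_semiregular_jacobian_of_count` — Jacobian anchor: `dim Fol ≤ 3g − 3 < C(g+1, 2) = dim 𝒜_g` for `g ≥ 4`
  (`jacobian_nc_iff`): translate-type / curve-bound designs at `J(C)`, `g ≥ 4`, are not `G`-semiregular; `g ≤ 3` is
  exactly the window of the genus-3 theorem ([Mar25 Thm 8.3.1], not used).
-/

open scoped BigOperators
open Finset

namespace Summit.Ventures.HSemireg.ObstructionLocus

variable {K : Type*} [Field K]

/-- An object at some anchor, seen through the pp directions `V` only: its follow-set `Fol(F) ∩ V` (the pp directions along
which `ob_F = 0`), the `G`-invariant pp directions `A^G ⊆ V`, and the abstract verdict «`G`-semiregular». -/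
structure AnchoredObject (K : Type*) [Field K] (V : Type*) [AddCommGroup V] [Module K V] where
  /-- `Fol(F) ∩ V`: the pp directions `ξ` with `ob_F(ξ) = 0`. -/
  follow : Submodule K V
  /-- `A^G`: the `G`-invariant pp directions (all of `V` for `G ⊂` translations `⋊ ⟨ι⟩`). -/
  invariant : Submodule K V
  /-- `F` is `G`-semiregular. -/
  GSemiregular : Prop

namespace AnchoredObject

variable {V : Type*} [AddCommGroup V] [Module K V] (F : AnchoredObject K V)

/-- **(H-NC′)** «semiregularity forces the invariant pp directions»: `G`-semiregular ⟹ `A^G ≤ Fol(F)`.  ON PAPER: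
`σ_F(ob_F(ξ)) = ± ξ ⌟ ch(F) = 0` for pp `ξ` and `ob_F(ξ) ∈ (Ext²)^G` for invariant `ξ` (Buchweitz–Flenner 2003 §4 / 2008
Prop. 6.4.4; (S1)(S2) of STRUCTURE §2).  A NAMED HYPOTHESIS SHAPE, not a Lean theorem. -/
def HNC : Prop := F.GSemiregular → F.invariant ≤ F.follow

/-- **(NC) by dimension count.**  If the invariant pp directions have larger dimension than the part of them the object
follows, the object is NOT `G`-semiregular (modulo (H-NC′)). -/
theorem not_semiregular_of_finrank_lt [FiniteDimensional K V] (hNC : F.HNC)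
    (h : Module.finrank K ↥(F.follow ⊓ F.invariant) < Module.finrank K F.invariant) : ¬ F.GSemiregular := by
  intro hSR
  have hle : F.invariant ≤ F.follow ⊓ F.invariant := le_inf (hNC hSR) le_rfl
  have := Submodule.finrank_mono hle
  omega

/-- Variant with `A^G = ⊤` (every pp direction invariant): `dim Fol < dim V ⟹` NOT semiregular. -/
theorem not_semiregular_of_finrank_lt_top [FiniteDimensional K V] (hNC : F.HNC) (htop : F.invariant = ⊤)
    (h : Module.finrank K F.follow < Module.finrank K V) : ¬ F.GSemiregular := by
  refine F.not_semiregular_of_finrank_lt hNC ?_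
  rw [htop, inf_top_eq, finrank_top]
  exact h

end AnchoredObject

/-! ## Follow-set 1: the reducible point, COUNT route -/

section Reducible

variable {n : ℕ}

/-- **Reducible point by count.**  An object at `X = Eⁿ` whose follow-set inside the pp directions (coordinates `PPData`)
is contained in that of `W` — the kernel of the Kodaira map, i.e. the `n` factor directions (file II; this containment
is (H-arr) of file I read in coordinates) — and for which every pp direction is `G`-invariant, is NOT `G`-semiregular for
`n ≥ 3`: `dim Fol ≤ n < n + C(n,2)`. -/
theorem not_semiregular_reducible_of_count (hn : 3 ≤ n) (F : AnchoredObject K (PPData K n)) (hNC : F.HNC)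
    (htop : F.invariant = ⊤)
    (hArr : F.follow ≤ LinearMap.ker (kodairaMap ∘ₗ ppDirOf (K := K) (n := n))) : ¬ F.GSemiregular := by
  refine F.not_semiregular_of_finrank_lt_top hNC htop ?_
  have h1 := Submodule.finrank_mono hArr
  rw [finrank_ker_kodairaMap_pp hn] at h1
  rw [finrank_PPData]
  have : 0 < n.choose 2 := Nat.choose_pos (by omega)
  omega

end Reducible

/-! ## Follow-set 2: the Jacobian anchor -/

section Jacobian

variable {V : Type*} [AddCommGroup V] [Module K V] [FiniteDimensional K V]

/-- **Jacobian anchor by count.**  At `J(C)`, `g ≥ 4`: if the pp directions have dimension `dim 𝒜_g = C(g+1, 2)`, every one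
of them is `G`-invariant, and the object follows at most `dim 𝓜_g = 3g − 3` of them (curve-bound / translate-type `W_d`
designs: `Fol = T𝓜_g`, Lombardi–Tirabassi Cor. 1.5 — entering only as this bound), then it is NOT `G`-semiregular.  For
`g ≤ 3` the count is silent (`jacobian_nc_iff`): the genus-3 theorem lives exactly there. -/
theorem not_semiregular_jacobian_of_count {g : ℕ} (hg : 4 ≤ g) (F : AnchoredObject K V) (hNC : F.HNC)
    (htop : F.invariant = ⊤) (hV : Module.finrank K V = (g + 1).choose 2)
    (hFol : Module.finrank K F.follow ≤ 3 * g - 3) : ¬ F.GSemiregular := by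
  refine F.not_semiregular_of_finrank_lt_top hNC htop ?_
  rw [hV]
  have hnc : ¬ ((g + 1).choose 2 ≤ 3 * g - 3) := fun h => by
    have := (jacobian_nc_iff (n := g) (by omega)).1 h
    omega
  omega

omit [FiniteDimensional K V] in
/-- The excess in the Jacobian count is exactly `C(g−2, 2)` (`1, 3, 6` at `g = 4, 5, 6`): `dim 𝒜_g − dim Fol ≥ C(g−2,2)`. -/
theorem jacobian_excess_le {g : ℕ} (hg : 2 ≤ g) (F : AnchoredObject K V)
    (hV : Module.finrank K V = (g + 1).choose 2) (hFol : Module.finrank K F.follow ≤ 3 * g - 3) :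
    (g - 2).choose 2 + Module.finrank K F.follow ≤ Module.finrank K V := by
  rw [hV, siegel_sub_moduli hg]
  omega

end Jacobian

end Summit.Ventures.HSemireg.ObstructionLocus
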